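import Summits.AtomisticToContinuum.Crystallization.Theorems.FrustratedLawDichotomyStrainedPatchHomLeafTableSoundHcpA
import Summits.AtomisticToContinuum.Crystallization.Theorems.FrustratedLawDichotomyStrainedPatchHomLeafTableRowK

/-!
# hcp table leaf checker — SOUNDNESS of `leafCheckH` in POINTS FORM (frame-free)

decomp-a2c hand-2 g24 (crux `AperiodicFrustratedLawGap`, stmt-AtomisticToContinuum-27623; β2-hcp, critic rows 864/865).  ★★★ `leafCheckH_sound_points`:
if the table is SEMANTICALLY certified (`TabSem E tab`: every row the lookup can return satisfies the common conclusion `RowSem` of hand-1's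
`Row.ok_sound` (v2) and `Row.okK_sound` (v3 "K") — so the hcp leaf is ROW-VERSION-AGNOSTIC: `tabSem_of_allOK`, `tabSem_of_allOKK`), the records are consistent (`NH.ok`) and pairwise distinct, their class magnitudes have sums `≤ Aⱼ`, and
`leafCheckH tab labs E A₀…A₉ k sμ aμ = true`, then for every point `x : Fin 10 → ℝ` of the class box `k`:
(i) `±aμ/(2·SC) ≤ Σ_{treated records l} W₄₅(√(Σⱼ L_lⱼ xⱼ))` and (ii) every untreated record has `Σⱼ L_lⱼ xⱼ ≥ 81/4` (its term is beyond the cutoff).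
The factor `2` is hand-1's final inequality verbatim (it carries the fcc `±`-half-set doubling); the hcp entry leaf calls the checker with the doubled
target.  The proof is the assembly of `acc_sumsH` against the generic `…HomLeafPoints.leaf_sound_points` with `Row.ok_sound` per treated record.
The frame-specific step (class point of `(U, hexFrame, hcpShift + ξ)`, label sums over `[−7,7]³`, far labels) is the companion `…HomLeafTableHcp`.
0 sorry; standard axioms.  `--supports stmt-AtomisticToContinuum-27623`.
-/

noncomputable section

namespace Summit.AtomisticToContinuum.Crystallization.Theorems.FrustratedLawDichotomyStrainedPatchHomLeafTableCheckHcp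

open scoped BigOperators
open Set
open Literature.Analysis.ValidatedNumerics.Numerics
open Summit.AtomisticToContinuum.Crystallization.Theorems.FrustratedLawDichotomySchurCut (effPot w₄₅ ω₄)
open Summit.AtomisticToContinuum.Crystallization.Theorems.FrustratedLawDichotomyStrainedPatchHomTermCalculus (hasDerivAt_phi45)
open Summit.AtomisticToContinuum.Crystallization.Theorems.FrustratedLawDichotomyStrainedPatchHomLeafPoints (leaf_sound_points)
open Summit.AtomisticToContinuum.Crystallization.Theorems.FrustratedLawDichotomyStrainedPatchHomLeafTableCheck
  (Row QT sgnZ SCN addP addN sx absDiff addP_eq addN_eq addP_sub_addN sgnZ_mul sgnZ_sx natAbs_sgnZ abs_sgnZ absDiff_cast SCN_eq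
   Row.ok_sound QT.findLE_none_ok Row.okK_sound QT.findLE_none_okK)

/-! ## §1. Row semantics (version-agnostic table certification) -/

/-- ROW SEMANTICS at derivative half-width `E`: the common conclusion of hand-1's `Row.ok_sound` (v2) and `Row.okK_sound` (v3 "K") — value bound at the
grid point, derivative enclosure, curvature constant on `[A, B]`, `0 < A ≤ t ≤ B` (reals = data / `SC`). -/
def RowSem (E : ℕ) (r : Row) : Prop :=
  ((sgnZ r.sV r.aV : ℤ) : ℝ) / SC ≤ effPot w₄₅ ω₄ (3 / 400) (Real.sqrt (((r.t : ℤ) : ℝ) / SC)) ∧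
    deriv (effPot w₄₅ ω₄ (3 / 400)) (Real.sqrt (((r.t : ℤ) : ℝ) / SC)) / (2 * Real.sqrt (((r.t : ℤ) : ℝ) / SC)) ∈
      Icc (((sgnZ r.sD r.aD - (E : ℤ) : ℤ) : ℝ) / SC) (((sgnZ r.sD r.aD + (E : ℤ) : ℤ) : ℝ) / SC) ∧
    0 ≤ ((r.M : ℤ) : ℝ) / SC ∧
    MonotoneOn (fun t => deriv (effPot w₄₅ ω₄ (3 / 400)) (Real.sqrt t) / (2 * Real.sqrt t) + ((r.M : ℤ) : ℝ) / SC * t)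
      (Icc (((r.A : ℤ) : ℝ) / SC) (((r.B : ℤ) : ℝ) / SC)) ∧
    0 < r.A ∧ r.A ≤ r.t ∧ r.t ≤ r.B

/-- A table is SEMANTICALLY CERTIFIED at `E`: every row the lookup `findLE · tab none` can return satisfies `RowSem E`. -/
def TabSem (E : ℕ) (tab : QT) : Prop := ∀ (q : ℕ) (r : Row), tab.findLE q none = some r → RowSem E r

/-- v2 tables (`Row.ok` / `QT.allOK`) are semantically certified. [formal bookkeeping] -/
theorem tabSem_of_allOK {E : ℕ} {tab : QT} (h : tab.allOK E = true) : TabSem E tab :=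
  fun _ _ hr => Row.ok_sound (QT.findLE_none_ok h hr)

/-- v3 ("K") tables (`Row.okK` / `QT.allOKK`, hand-1 g22) are semantically certified. [formal bookkeeping] -/
theorem tabSem_of_allOKK {E P : ℕ} {tab : QT} (h : tab.allOKK E P = true) : TabSem E tab :=
  fun _ _ hr => Row.okK_sound (QT.findLE_none_okK h hr)

/-- A treated label's facts from a semantically certified table: `qNegH + radH ≤ qPosH`, the range test of its row, and the row's semantics.
[formal bookkeeping] -/
theorem treatedH_factsSem {tab : QT} {E : ℕ} (htab : TabSem E tab) {k : LH} {l : NH} (ht : treatedH tab k l = true) :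
    qNegH k l + radH k l ≤ qPosH k l ∧ (rowTH tab k l).A ≤ q0NH k l - radH k l ∧ q0NH k l + radH k l ≤ (rowTH tab k l).B ∧
      (rowTH tab k l).t ≤ q0NH k l ∧ RowSem E (rowTH tab k l) := by
  obtain ⟨h1, -, row, hr, hrange⟩ := rowOfH_of_treated ht
  have hrow : rowTH tab k l = row := by unfold rowTH; rw [hr]
  rw [hrow]
  unfold rangeBH at hrange
  simp only [Bool.and_eq_true, Nat.ble_eq] at hrange
  exact ⟨Nat.le_of_ble_eq_true h1, hrange.1.1, hrange.1.2, hrange.2, htab _ _ hr⟩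

/-! ## §2. ★★★ Soundness in points form -/

open Classical in
/-- ★★★ **SOUNDNESS OF THE hcp TABLE LEAF CHECK, points form.**  See the module docstring. [folklore] -/
theorem leafCheckH_sound_points {tab : QT} {labs : List NH} {E A0 A1 A2 A3 A4 A5 A6 A7 A8 A9 : ℕ} {k : LH} {sμ : Bool} {aμ : ℕ}
    (htab : TabSem E tab) (hok : ∀ l ∈ labs, l.ok = true) (hnd : labs.Nodup)
    (hA : ∀ j : Fin 10, (labs.map (fun l => l.mag j)).sum ≤ vec10 A0 A1 A2 A3 A4 A5 A6 A7 A8 A9 j)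
    (h : leafCheckH tab labs E A0 A1 A2 A3 A4 A5 A6 A7 A8 A9 k sμ aμ = true)
    (x : Fin 10 → ℝ) (hbox : ∀ j, |x j - ((k.cZ j : ℤ) : ℝ) / SC| ≤ ((k.wN j : ℕ) : ℝ) / SC) :
    ((sgnZ sμ aμ : ℤ) : ℝ) / SC / 2 ≤
        ∑ l ∈ (labs.filter (fun l => treatedH tab k l)).toFinset, effPot w₄₅ ω₄ (3 / 400) (Real.sqrt (∑ j, ((l.Lz j : ℤ) : ℝ) * x j)) ∧
      ∀ l ∈ labs, treatedH tab k l = false → (81 : ℝ) / 4 ≤ ∑ j, ((l.Lz j : ℤ) : ℝ) * x j := by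
  classical
  have hS := SC_pos
  unfold leafCheckH at h
  obtain ⟨hokA, hle⟩ := finalH_true h
  obtain ⟨hall, eV, eD, eS, eG, eC⟩ := acc_sumsH hokA
  set a := foldH tab k accH0 labs with ha
  set T := labs.filter (fun l => treatedH tab k l) with hT
  have hTsub : T.Sublist labs := List.filter_sublist
  have hTmem : ∀ l ∈ T, l ∈ labs := fun l hl => hTsub.subset hl
  have hTt : ∀ l ∈ T, treatedH tab k l = true := fun l hl => (List.mem_filter.1 hl).2
  have hTnd : T.Nodup := hnd.sublist hTsub
  set S : Finset NH := T.toFinset with hSdef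
  have hmemS : ∀ l, l ∈ S ↔ l ∈ T := fun l => List.mem_toFinset
  refine ⟨?_, fun l hl ht => ?_⟩
  swap
  · -- (ii) untreated records are far by the box
    obtain ⟨hq, hfb⟩ := farBH_of_untreated (hall l hl) ht
    exact far_of_farBH (hok l hl) hq hfb x hbox
  -- per-record facts for treated labels
  have hF : ∀ l ∈ S, qNegH k l + radH k l ≤ qPosH k l ∧ (rowTH tab k l).A ≤ q0NH k l - radH k l ∧ q0NH k l + radH k l ≤ (rowTH tab k l).B ∧
      (rowTH tab k l).t ≤ q0NH k l ∧ RowSem E (rowTH tab k l) := fun l hl => treatedH_factsSem htab (hTt l ((hmemS l).1 hl))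
  -- real data
  let Lf : NH → Fin 10 → ℝ := fun l j => ((l.Lz j : ℤ) : ℝ)
  let c0f : Fin 10 → ℝ := fun j => ((k.cZ j : ℤ) : ℝ) / SC
  let wf : Fin 10 → ℝ := fun j => ((k.wN j : ℕ) : ℝ) / SC
  -- δ in ℕ is exact
  have hdlt : ∀ l ∈ S, (((dltH tab k l : ℕ) : ℤ) : ℝ) = ((((qPosH k l : ℕ) : ℤ) - ((qNegH k l : ℕ) : ℤ) : ℤ) : ℝ) - (((rowTH tab k l).t : ℤ) : ℝ) := by
    intro l hl
    obtain ⟨h1, -, -, h4, -⟩ := hF l hl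
    have hq : qNegH k l ≤ qPosH k l := le_trans (Nat.le_add_right _ _) h1
    unfold dltH q0NH
    have e : ((qPosH k l - qNegH k l - (rowTH tab k l).t : ℕ) : ℤ) = (qPosH k l : ℤ) - (qNegH k l : ℤ) - ((rowTH tab k l).t : ℤ) := by
      unfold q0NH at h4; omega
    exact_mod_cast e
  have hell0 : ∀ l ∈ S, ∑ j, Lf l j * c0f j = ((((qPosH k l : ℕ) : ℤ) - ((qNegH k l : ℕ) : ℤ) : ℤ) : ℝ) / SC :=
    fun l hl => ell0H_eq (hok l (hTmem l ((hmemS l).1 hl))) k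
  have hrad : ∀ l ∈ S, ∑ j, |Lf l j| * wf j = (((radH k l : ℕ) : ℤ) : ℝ) / SC :=
    fun l hl => radH_real_eq (hok l (hTmem l ((hmemS l).1 hl))) k
  have RS : ∀ l ∈ S, RowSem E (rowTH tab k l) := fun l hl => (hF l hl).2.2.2.2
  have hmain := leaf_sound_points S Lf (fun _ q => effPot w₄₅ ω₄ (3 / 400) (Real.sqrt q))
    (fun _ t => deriv (effPot w₄₅ ω₄ (3 / 400)) (Real.sqrt t) / (2 * Real.sqrt t))
    (fun l => (((rowTH tab k l).A : ℤ) : ℝ) / SC) (fun l => (((rowTH tab k l).B : ℤ) : ℝ) / SC) (fun l => (((rowTH tab k l).M : ℤ) : ℝ) / SC)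
    (fun l => (((rowTH tab k l).t : ℤ) : ℝ) / SC) (fun l => ((sgnZ (rowTH tab k l).sV (rowTH tab k l).aV : ℤ) : ℝ) / SC)
    (fun l => ((sgnZ (rowTH tab k l).sD (rowTH tab k l).aD - (E : ℤ) : ℤ) : ℝ) / SC)
    (fun l => ((sgnZ (rowTH tab k l).sD (rowTH tab k l).aD + (E : ℤ) : ℤ) : ℝ) / SC) c0f wf
    (((sgnZ sμ aμ : ℤ) : ℝ) / SC / 2)
    (fun j => div_nonneg (by exact_mod_cast Nat.zero_le _) hS.le)
    (fun l hl => (RS l hl).2.2.1)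
    (fun l hl t ht => hasDerivAt_phi45 (lt_of_lt_of_le (div_pos (by exact_mod_cast (RS l hl).2.2.2.2.1) hS) ht.1))
    (fun l hl => (RS l hl).2.2.2.1)
    (fun l hl => ⟨div_le_div_of_nonneg_right (by exact_mod_cast (RS l hl).2.2.2.2.2.1) hS.le,
      div_le_div_of_nonneg_right (by exact_mod_cast (RS l hl).2.2.2.2.2.2) hS.le⟩)
    ?hlo ?hhi (fun l hl => (RS l hl).1) (fun l hl => (RS l hl).2.1) ?hcheck x hbox
  · exact hmain
  case hlo =>
    intro l hl
    rw [hell0 l hl, hrad l hl, ← sub_div]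
    refine div_le_div_of_nonneg_right ?_ hS.le
    obtain ⟨h1, h2, -, -, -⟩ := hF l hl
    have hq : qNegH k l ≤ qPosH k l := le_trans (Nat.le_add_right _ _) h1
    have : ((rowTH tab k l).A : ℤ) ≤ (qPosH k l : ℤ) - qNegH k l - radH k l := by unfold q0NH at h2; omega
    exact_mod_cast this
  case hhi =>
    intro l hl
    rw [hell0 l hl, hrad l hl, ← add_div]
    refine div_le_div_of_nonneg_right ?_ hS.le
    obtain ⟨h1, -, h3, -, -⟩ := hF l hl
    have hq : qNegH k l ≤ qPosH k l := le_trans (Nat.le_add_right _ _) h1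
    have : (qPosH k l : ℤ) - qNegH k l + radH k l ≤ ((rowTH tab k l).B : ℤ) := by unfold q0NH at h3; omega
    exact_mod_cast this
  case hcheck =>
    have hδ : ∀ l ∈ S, ∑ j, Lf l j * c0f j - (((rowTH tab k l).t : ℤ) : ℝ) / SC = (((dltH tab k l : ℕ) : ℤ) : ℝ) / SC := by
      intro l hl; rw [hell0 l hl, hdlt l hl, sub_div]
    have hδ0 : ∀ l ∈ S, (0:ℝ) ≤ (((dltH tab k l : ℕ) : ℤ) : ℝ) / SC := fun l _ => div_nonneg (by exact_mod_cast Nat.zero_le _) hS.le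
    -- (i) values
    have hSV : ∑ l ∈ S, ((sgnZ (rowTH tab k l).sV (rowTH tab k l).aV : ℤ) : ℝ) / SC = ((((a.vP : ℕ) : ℤ) - ((a.vN : ℕ) : ℤ) : ℤ) : ℝ) / SC := by
      rw [← Finset.sum_div, hSdef, List.sum_toFinset _ hTnd, cast_list_sum_intG, ← eV]
    -- (ii) centre corrections
    have hSD : ∑ l ∈ S, min ((((sgnZ (rowTH tab k l).sD (rowTH tab k l).aD - (E : ℤ) : ℤ) : ℝ) / SC) *
          (∑ j, Lf l j * c0f j - (((rowTH tab k l).t : ℤ) : ℝ) / SC))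
        ((((sgnZ (rowTH tab k l).sD (rowTH tab k l).aD + (E : ℤ) : ℤ) : ℝ) / SC) * (∑ j, Lf l j * c0f j - (((rowTH tab k l).t : ℤ) : ℝ) / SC)) =
        (((((a.dP : ℕ) : ℤ) - ((a.dN : ℕ) : ℤ) : ℤ) : ℝ) - (E : ℝ) * ((a.sd : ℕ) : ℝ)) / SC ^ 2 := by
      have hterm : ∀ l ∈ S, min ((((sgnZ (rowTH tab k l).sD (rowTH tab k l).aD - (E : ℤ) : ℤ) : ℝ) / SC) *
          (∑ j, Lf l j * c0f j - (((rowTH tab k l).t : ℤ) : ℝ) / SC))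
          ((((sgnZ (rowTH tab k l).sD (rowTH tab k l).aD + (E : ℤ) : ℤ) : ℝ) / SC) * (∑ j, Lf l j * c0f j - (((rowTH tab k l).t : ℤ) : ℝ) / SC)) =
          (((sgnZ (rowTH tab k l).sD (rowTH tab k l).aD * (dltH tab k l : ℤ) : ℤ) : ℝ) - (E : ℝ) * ((dltH tab k l : ℕ) : ℝ)) / SC ^ 2 := by
        intro l hl
        rw [hδ l hl, min_eq_left (mul_le_mul_of_nonneg_right (div_le_div_of_nonneg_right (by push_cast; linarith) hS.le) (hδ0 l hl))]
        push_cast; field_simp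
      rw [Finset.sum_congr rfl hterm, ← Finset.sum_div, Finset.sum_sub_distrib, ← Finset.mul_sum, hSdef, List.sum_toFinset _ hTnd,
        List.sum_toFinset _ hTnd, cast_list_sum_intG, cast_list_sum_natG, ← eD, ← eS]
    -- (iv) curvature
    have hSC : ∑ l ∈ S, (((rowTH tab k l).M : ℤ) : ℝ) / SC * (|∑ j, Lf l j * c0f j - (((rowTH tab k l).t : ℤ) : ℝ) / SC| + ∑ j, |Lf l j| * wf j) ^ 2 =
        ((a.cur : ℕ) : ℝ) / SC ^ 3 := by
      have hterm : ∀ l ∈ S, (((rowTH tab k l).M : ℤ) : ℝ) / SC * (|∑ j, Lf l j * c0f j - (((rowTH tab k l).t : ℤ) : ℝ) / SC| + ∑ j, |Lf l j| * wf j) ^ 2 =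
          (((rowTH tab k l).M * ((dltH tab k l + radH k l) * (dltH tab k l + radH k l)) : ℕ) : ℝ) / SC ^ 3 := by
        intro l hl
        rw [hδ l hl, hrad l hl, abs_of_nonneg (hδ0 l hl)]
        push_cast; field_simp
      rw [Finset.sum_congr rfl hterm, ← Finset.sum_div, hSdef, List.sum_toFinset _ hTnd, cast_list_sum_natG, ← eC]
    -- (iii) gradient classes
    have hLc : ∀ l ∈ T, ∀ j, Lf l j = ((l.cls j : ℤ) : ℝ) := by
      intro l hl j; show ((l.Lz j : ℤ) : ℝ) = _; rw [NH.Lz_eq_cls (hok l (hTmem l hl))]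
    have cj : ∀ j : Fin 10, max |∑ l ∈ S, min (((sgnZ (rowTH tab k l).sD (rowTH tab k l).aD - (E : ℤ) : ℤ) : ℝ) / SC * Lf l j)
          (((sgnZ (rowTH tab k l).sD (rowTH tab k l).aD + (E : ℤ) : ℤ) : ℝ) / SC * Lf l j)|
        |∑ l ∈ S, max (((sgnZ (rowTH tab k l).sD (rowTH tab k l).aD - (E : ℤ) : ℤ) : ℝ) / SC * Lf l j)
          (((sgnZ (rowTH tab k l).sD (rowTH tab k l).aD + (E : ℤ) : ℤ) : ℝ) / SC * Lf l j)| ≤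
        ((absDiff (a.gP j) (a.gN j) + E * vec10 A0 A1 A2 A3 A4 A5 A6 A7 A8 A9 j : ℕ) : ℝ) / SC := by
      intro j
      rw [hSdef]
      exact class_boundD T hTnd (fun l => sgnZ (rowTH tab k l).sD (rowTH tab k l).aD) (fun l => Lf l j) (fun l => l.cls j) (fun l => l.mag j)
        (a.gP j) (a.gN j) _ (fun l hl => hLc l hl j) (fun l => NH.abs_cls l j) (eG j) ((sum_mag_filter_le labs _ j).trans (hA j))
    have hw0 : ∀ j, (0:ℝ) ≤ wf j := fun j => div_nonneg (by exact_mod_cast Nat.zero_le _) hS.le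
    have hSG : ∑ j, max |∑ l ∈ S, min (((sgnZ (rowTH tab k l).sD (rowTH tab k l).aD - (E : ℤ) : ℤ) : ℝ) / SC * Lf l j)
            (((sgnZ (rowTH tab k l).sD (rowTH tab k l).aD + (E : ℤ) : ℤ) : ℝ) / SC * Lf l j)|
          |∑ l ∈ S, max (((sgnZ (rowTH tab k l).sD (rowTH tab k l).aD - (E : ℤ) : ℤ) : ℝ) / SC * Lf l j)
            (((sgnZ (rowTH tab k l).sD (rowTH tab k l).aD + (E : ℤ) : ℤ) : ℝ) / SC * Lf l j)| * wf j ≤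
        ((gradPenH E A0 A1 A2 A3 A4 A5 A6 A7 A8 A9 k a : ℕ) : ℝ) / SC ^ 2 := by
      have hgp : ((gradPenH E A0 A1 A2 A3 A4 A5 A6 A7 A8 A9 k a : ℕ) : ℝ) / SC ^ 2 =
          ∑ j : Fin 10, ((absDiff (a.gP j) (a.gN j) + E * vec10 A0 A1 A2 A3 A4 A5 A6 A7 A8 A9 j : ℕ) : ℝ) / SC * wf j := by
        rw [gradPenH_eq_sum]; push_cast
        rw [Finset.sum_div]
        refine Finset.sum_congr rfl fun j _ => ?_
        simp only [wf]
        field_simp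
      rw [hgp]
      exact Finset.sum_le_sum fun j _ => mul_le_mul_of_nonneg_right (cj j) (hw0 j)
    -- (v) the integer inequality, scaled
    have hX : ((addP sμ aμ 0 : ℕ) : ℝ) - ((addN sμ aμ 0 : ℕ) : ℝ) = ((sgnZ sμ aμ : ℤ) : ℝ) := by exact_mod_cast addP_sub_addN sμ aμ
    have hleR : ((lhsH E (addP sμ aμ 0) (gradPenH E A0 A1 A2 A3 A4 A5 A6 A7 A8 A9 k a) a : ℕ) : ℝ) ≤ ((rhsH (addN sμ aμ 0) a : ℕ) : ℝ) := by
      exact_mod_cast hle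
    unfold lhsH rhsH at hleR
    simp only [Nat.add_eq, Nat.mul_eq, SCN_eq] at hleR
    push_cast at hleR
    have key : ((sgnZ sμ aμ : ℤ) : ℝ) * (SC : ℝ) ^ 2 ≤
        2 * (((((a.vP : ℕ) : ℤ) - ((a.vN : ℕ) : ℤ) : ℤ) : ℝ) * (SC : ℝ) ^ 2 +
          ((((((a.dP : ℕ) : ℤ) - ((a.dN : ℕ) : ℤ) : ℤ) : ℝ)) - (E : ℝ) * ((a.sd : ℕ) : ℝ)) * SC -
          ((gradPenH E A0 A1 A2 A3 A4 A5 A6 A7 A8 A9 k a : ℕ) : ℝ) * SC) - ((a.cur : ℕ) : ℝ) := by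
      rw [← hX]; push_cast; nlinarith [hleR]
    have key' : ((sgnZ sμ aμ : ℤ) : ℝ) / SC / 2 ≤ ((((a.vP : ℕ) : ℤ) - ((a.vN : ℕ) : ℤ) : ℤ) : ℝ) / SC +
        ((((((a.dP : ℕ) : ℤ) - ((a.dN : ℕ) : ℤ) : ℤ) : ℝ)) - (E : ℝ) * ((a.sd : ℕ) : ℝ)) / SC ^ 2 -
        ((gradPenH E A0 A1 A2 A3 A4 A5 A6 A7 A8 A9 k a : ℕ) : ℝ) / SC ^ 2 - 1 / 2 * (((a.cur : ℕ) : ℝ) / SC ^ 3) := by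
      have h3 : (0:ℝ) < 2 * (SC : ℝ) ^ 3 := by positivity
      have := div_le_div_of_nonneg_right key h3.le
      calc ((sgnZ sμ aμ : ℤ) : ℝ) / SC / 2 = ((sgnZ sμ aμ : ℤ) : ℝ) * (SC : ℝ) ^ 2 / (2 * (SC : ℝ) ^ 3) := by field_simp
        _ ≤ _ := this
        _ = _ := by field_simp
    rw [hSV, hSD, hSC]
    linarith [hSG, key']

end Summit.AtomisticToContinuum.Crystallization.Theorems.FrustratedLawDichotomyStrainedPatchHomLeafTableCheckHcp

end
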